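import Summits.AtomisticToContinuum.FouriersLaw.Theses.PuiseuxTransferLedger
import Summits.AtomisticToContinuum.FouriersLaw.Theorems.PhononMeanFreePathBoundaryKuboEnergyBalance

/-!
# The exact first-order contact identities (`ContactIdentity`), proved

Closes item `stmt-AtomisticToContinuum-12112` — the decl `ContactIdentity` of the route
`Summits/AtomisticToContinuum/FouriersLaw/Theses/PuiseuxTransferLedger`: for the pinned anharmonic chain
`pinnedChain ω₂ lam β γ` (all parameters `> 0`), under uniqueness of the weak steady state, along any
steady-state family `μ N T_L T_R`, at `T > 0` and `N ≥ 2`: if `d` is the response coefficient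
(`totalCurrent (μ N (T+δ/2) (T-δ/2)) / δ → d` as `δ → 0`, `δ ≠ 0`) and `a`, `b` are the responses of the kinetic
temperatures `∫ p_0² dμ`, `∫ p_{N-1}² dμ` at the two bath sites, then
`γ (1/2 - a) = d / (N - 1) = γ (b + 1/2)`.

Proof.
* Every weak steady state at positive temperatures has an exponential moment: the tree's existence theorem
  `CuneoEckmannHairerReyBellet2018_pinnedChain_holds` produces one with `e^{ϑH} ∈ L¹`, and uniqueness identifies
  it with the given one (`exists_expMoment`).
* Hence the energy balance of the tree applies (`BoundaryKubo.GibbsTtcf.stub_energyBalance`, `bath_balance`,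
  from weak stationarity tested on the block energies and on `H`): with `N = M + 1`,
  `totalCurrent μ_δ = M γ (T + δ/2 - ∫ p_0² dμ_δ) = M γ (∫ p_M² dμ_δ - (T - δ/2))` (`totalCurrent_eq_ends`).
* Elementary limit algebra (`eq_zero_of_tendsto_of_mul_eq`): the combination
  `F δ := (∫ p_0² dμ_δ - ∫ p_0² dμ_0)/δ - 1/2 + (totalCurrent μ_δ / δ)/(Mγ)` tends to `a - 1/2 + d/(Mγ)` and
  satisfies `F δ · δ = T - ∫ p_0² dμ_0` for `0 < |δ| < 2T`; a function with a finite limit on `𝓝[≠] 0`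
  whose product with `δ` is constant forces that constant, and then the limit, to vanish. (In particular the
  equilibrium value `∫ p_0² dμ_(N,T,T) = T` is a by-product, not an input.) The right contact is symmetric.

References: Bonetto–Lebowitz–Rey-Bellet 2000 §5.2 (25)–(27); Lepri–Livi–Politi 2003 §2;
Cuneo–Eckmann–Hairer–Rey-Bellet 2018 Thm 2.13(2).
-/

noncomputable section

open MeasureTheory Filter Topology Set

namespace Summit.AtomisticToContinuum.FouriersLaw.Theorems

namespace ContactIdentity

open Literature.MathematicalPhysics.KineticTheory.HeatConduction
open Summit.AtomisticToContinuum.FouriersLaw.Theorems.BoundaryKubo.GibbsTtcf (stub_energyBalance bath_balance)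
open Summit.AtomisticToContinuum.FouriersLaw.Theorems.LinearResponseFTUR (pinnedChain_polynomialMoments)

/-- Under uniqueness of the weak steady state, every weak steady state of the pinned chain (`M + 1 ≥ 1` sites,
positive bath temperatures) integrates `e^{θH}` for some `θ > 0`: it coincides with the steady state produced
by Cuneo–Eckmann–Hairer–Rey-Bellet 2018, Thm 2.13, which does. [cite: CuneoEckmannHairerReyBellet2018, Thm 2.13] -/
theorem exists_expMoment {ω₂ lam β γ : ℝ} (hω : 0 < ω₂) (hl : 0 < lam) (hβ : 0 < β) (hγ : 0 < γ)
    (huniq : ∀ (N : ℕ) (T_L T_R : ℝ), 0 < T_L → 0 < T_R →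
      ∀ μ ν : Measure (PhaseSpace N), (pinnedChain ω₂ lam β γ).IsSteadyState N T_L T_R μ →
        (pinnedChain ω₂ lam β γ).IsSteadyState N T_L T_R ν → μ = ν)
    {M : ℕ} {T_L T_R : ℝ} (hL : 0 < T_L) (hR : 0 < T_R) {ν : Measure (PhaseSpace (M + 1))}
    (hν : (pinnedChain ω₂ lam β γ).IsSteadyState (M + 1) T_L T_R ν) :
    ∃ θ : ℝ, 0 < θ ∧
      Integrable (fun z => Real.exp (θ * (pinnedChain ω₂ lam β γ).hamiltonian (M + 1) z)) ν := by
  obtain ⟨ν', hν', -, hexp⟩ := CuneoEckmannHairerReyBellet2018_pinnedChain_holds ω₂ lam β γ hω hl hβ hγ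
    (M + 1) T_L T_R (Nat.succ_pos M) hL hR
  have hmax : 0 < 1 / max T_L T_R := one_div_pos.2 (lt_max_of_lt_left hL)
  refine ⟨1 / max T_L T_R / 2, by positivity, ?_⟩
  rw [huniq _ _ _ hL hR ν ν' hν hν']
  exact hexp _ (by positivity) (by linarith)

/-- **The two contact forms of the steady current.** For a weak steady state `ν` of the pinned chain with
`M + 1` sites at bath temperatures `T_L, T_R > 0` having an exponential moment:
`totalCurrent ν = M γ (T_L - ∫ p_0² dν) = M γ (∫ p_M² dν - T_R)` — the power injected by the left bath equals
the power absorbed by the right bath equals every bond current (tree: `stub_energyBalance`, `bath_balance`).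
[cite: BonettoLebowitzReyBellet2000, §5.2 eqs. (25)–(27)] -/
theorem totalCurrent_eq_ends {ω₂ lam β γ : ℝ} (hω : 0 < ω₂) (hl : 0 < lam) (hβ : 0 < β) (hγ : 0 < γ)
    {M : ℕ} {T_L T_R : ℝ} (hL : 0 < T_L) (hR : 0 < T_R) {ν : Measure (PhaseSpace (M + 1))}
    (hν : (pinnedChain ω₂ lam β γ).IsSteadyState (M + 1) T_L T_R ν)
    (hexp : ∃ θ : ℝ, 0 < θ ∧
      Integrable (fun z => Real.exp (θ * (pinnedChain ω₂ lam β γ).hamiltonian (M + 1) z)) ν) :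
    (pinnedChain ω₂ lam β γ).totalCurrent ν = (M : ℝ) * γ * (T_L - ∫ z, (z.2 0) ^ 2 ∂ν) ∧
      (pinnedChain ω₂ lam β γ).totalCurrent ν =
        (M : ℝ) * γ * ((∫ z, (z.2 (Fin.last M)) ^ 2 ∂ν) - T_R) := by
  have h2 := stub_energyBalance ω₂ lam β γ hω hl hβ hγ M T_L T_R hL hR ν hν hexp
  obtain ⟨θ, hθ, hint⟩ := hexp
  have hmom := pinnedChain_polynomialMoments ω₂ lam β γ hω.le hl.le hβ.le (M + 1) ν θ hθ hint
  have hbal := bath_balance hω hl.le hβ.le hγ.le hL.le hR.le hν hmom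
  refine ⟨?_, h2⟩
  rw [h2]
  linear_combination (-(M : ℝ)) * hbal

/-- **Limit algebra.** If `F δ → L` as `δ → 0`, `δ ≠ 0`, and `F δ · δ = c` for all small `δ ≠ 0`, then
`c = 0` and `L = 0` (`F δ · δ → L · 0`, and then `F` vanishes near `0`). [folklore] -/
theorem eq_zero_of_tendsto_of_mul_eq {F : ℝ → ℝ} {c L : ℝ} (hF : Tendsto F (𝓝[≠] 0) (𝓝 L))
    (hc : ∀ᶠ δ in 𝓝[≠] (0 : ℝ), F δ * δ = c) : c = 0 ∧ L = 0 := by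
  have hδ : Tendsto (fun δ : ℝ => δ) (𝓝[≠] (0 : ℝ)) (𝓝 0) :=
    tendsto_nhdsWithin_of_tendsto_nhds tendsto_id
  have h1 : Tendsto (fun δ => F δ * δ) (𝓝[≠] (0 : ℝ)) (𝓝 (L * 0)) := hF.mul hδ
  rw [mul_zero] at h1
  have hc0 : c = 0 :=
    tendsto_nhds_unique (tendsto_const_nhds : Tendsto (fun _ : ℝ => c) (𝓝[≠] (0 : ℝ)) (𝓝 c))
      (h1.congr' hc)
  refine ⟨hc0, ?_⟩
  subst hc0
  have h3 : F =ᶠ[𝓝[≠] (0 : ℝ)] fun _ => (0 : ℝ) := by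
    filter_upwards [hc, self_mem_nhdsWithin] with δ hδ hδ0
    rcases mul_eq_zero.1 hδ with h | h
    · exact h
    · exact absurd h hδ0
  exact tendsto_nhds_unique hF (tendsto_const_nhds.congr' h3.symm)

end ContactIdentity

open Literature.MathematicalPhysics.KineticTheory.HeatConduction ContactIdentity in
/-- **`ContactIdentity` (item stmt-AtomisticToContinuum-12112), proved.** For `pinnedChain ω₂ lam β γ`
(all `> 0`), under uniqueness of the weak steady state, along any steady-state family, for `T > 0`, `N ≥ 2`,
the bath sites `i = 0`, `j = N - 1`, the response coefficient `d` and the kinetic-temperature responses `a`, `b`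
at the two bath sites: `γ (1/2 - a) = d / (N - 1)` and `γ (b + 1/2) = d / (N - 1)` — the boundary rows of the
two-point contact problem, from the exact energy balance `J = γ (T_L - ⟨p_0²⟩) = γ (⟨p_{N-1}²⟩ - T_R)` at every
`δ` and elementary limit algebra. [cite: BonettoLebowitzReyBellet2000, §5.2 eqs. (25)–(27)] -/
theorem contactIdentity_proof :
    Summit.AtomisticToContinuum.FouriersLaw.Theses.PuiseuxTransferLedger.ContactIdentity := by
  intro ω₂ lam β γ hω hl hβ hγ huniq μ hμ T hT N d a b i j hN hi hj hd ha hb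
  obtain ⟨M, rfl⟩ : ∃ M, N = M + 1 := ⟨N - 1, by omega⟩
  have hi0 : i = 0 := Fin.ext (by rw [hi, Fin.val_zero])
  have hjl : j = Fin.last M := Fin.ext (by rw [Fin.val_last]; omega)
  subst hi0 hjl
  have hM0 : (M : ℝ) ≠ 0 := by exact_mod_cast (show M ≠ 0 by omega)
  have hMγ : (M : ℝ) * γ ≠ 0 := mul_ne_zero hM0 hγ.ne'
  have hcast : ((M + 1 : ℕ) : ℝ) - 1 = (M : ℝ) := by push_cast; ring
  rw [hcast]
  -- the bath temperatures `T ± δ/2` are positive near `δ = 0`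
  have hev : ∀ᶠ δ in 𝓝[≠] (0 : ℝ), 0 < T + δ / 2 ∧ 0 < T - δ / 2 := by
    refine eventually_nhdsWithin_of_eventually_nhds ?_
    have h1 : Tendsto (fun δ : ℝ => T + δ / 2) (𝓝 0) (𝓝 (T + 0 / 2)) :=
      tendsto_const_nhds.add (tendsto_id.div_const 2)
    have h2 : Tendsto (fun δ : ℝ => T - δ / 2) (𝓝 0) (𝓝 (T - 0 / 2)) :=
      tendsto_const_nhds.sub (tendsto_id.div_const 2)
    simp only [zero_div, add_zero, sub_zero] at h1 h2
    exact (h1.eventually (lt_mem_nhds hT)).and (h2.eventually (lt_mem_nhds hT))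
  -- the contact forms of the current at every admissible `δ`
  have hid : ∀ δ : ℝ, 0 < T + δ / 2 → 0 < T - δ / 2 →
      (pinnedChain ω₂ lam β γ).totalCurrent (μ (M + 1) (T + δ / 2) (T - δ / 2)) =
          (M : ℝ) * γ * (T + δ / 2 - ∫ z, (z.2 0) ^ 2 ∂(μ (M + 1) (T + δ / 2) (T - δ / 2))) ∧
        (pinnedChain ω₂ lam β γ).totalCurrent (μ (M + 1) (T + δ / 2) (T - δ / 2)) =
          (M : ℝ) * γ * ((∫ z, (z.2 (Fin.last M)) ^ 2 ∂(μ (M + 1) (T + δ / 2) (T - δ / 2))) -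
            (T - δ / 2)) := by
    intro δ h1 h2
    have hν := hμ (M + 1) _ _ h1 h2
    exact totalCurrent_eq_ends hω hl hβ hγ h1 h2 hν (exists_expMoment hω hl hβ hγ huniq h1 h2 hν)
  constructor
  · -- left contact: `F δ · δ = T - ∫ p_0² dμ_0`
    have hF : Tendsto (fun δ : ℝ =>
        ((∫ z, (z.2 0) ^ 2 ∂(μ (M + 1) (T + δ / 2) (T - δ / 2))) - ∫ z, (z.2 0) ^ 2 ∂(μ (M + 1) T T)) / δ -
          1 / 2 +
          (pinnedChain ω₂ lam β γ).totalCurrent (μ (M + 1) (T + δ / 2) (T - δ / 2)) / δ / ((M : ℝ) * γ))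
        (𝓝[≠] 0) (𝓝 (a - 1 / 2 + d / ((M : ℝ) * γ))) :=
      (ha.sub tendsto_const_nhds).add (hd.div_const _)
    have hc : ∀ᶠ δ in 𝓝[≠] (0 : ℝ),
        (((∫ z, (z.2 0) ^ 2 ∂(μ (M + 1) (T + δ / 2) (T - δ / 2))) - ∫ z, (z.2 0) ^ 2 ∂(μ (M + 1) T T)) / δ -
          1 / 2 +
          (pinnedChain ω₂ lam β γ).totalCurrent (μ (M + 1) (T + δ / 2) (T - δ / 2)) / δ / ((M : ℝ) * γ)) *
          δ = T - ∫ z, (z.2 0) ^ 2 ∂(μ (M + 1) T T) := by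
      filter_upwards [hev, self_mem_nhdsWithin] with δ hδ hδ0
      have hδ0' : δ ≠ 0 := hδ0
      rw [(hid δ hδ.1 hδ.2).1]
      field_simp
      ring
    have hL := (eq_zero_of_tendsto_of_mul_eq hF hc).2
    field_simp at hL
    field_simp
    linarith
  · -- right contact: `F δ · δ = T - ∫ p_M² dμ_0`
    have hF : Tendsto (fun δ : ℝ =>
        ((∫ z, (z.2 (Fin.last M)) ^ 2 ∂(μ (M + 1) (T + δ / 2) (T - δ / 2))) -
            ∫ z, (z.2 (Fin.last M)) ^ 2 ∂(μ (M + 1) T T)) / δ + 1 / 2 -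
          (pinnedChain ω₂ lam β γ).totalCurrent (μ (M + 1) (T + δ / 2) (T - δ / 2)) / δ / ((M : ℝ) * γ))
        (𝓝[≠] 0) (𝓝 (b + 1 / 2 - d / ((M : ℝ) * γ))) :=
      (hb.add tendsto_const_nhds).sub (hd.div_const _)
    have hc : ∀ᶠ δ in 𝓝[≠] (0 : ℝ),
        (((∫ z, (z.2 (Fin.last M)) ^ 2 ∂(μ (M + 1) (T + δ / 2) (T - δ / 2))) -
            ∫ z, (z.2 (Fin.last M)) ^ 2 ∂(μ (M + 1) T T)) / δ + 1 / 2 -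
          (pinnedChain ω₂ lam β γ).totalCurrent (μ (M + 1) (T + δ / 2) (T - δ / 2)) / δ / ((M : ℝ) * γ)) *
          δ = T - ∫ z, (z.2 (Fin.last M)) ^ 2 ∂(μ (M + 1) T T) := by
      filter_upwards [hev, self_mem_nhdsWithin] with δ hδ hδ0
      have hδ0' : δ ≠ 0 := hδ0
      rw [(hid δ hδ.1 hδ.2).2]
      field_simp
      ring
    have hL := (eq_zero_of_tendsto_of_mul_eq hF hc).2
    field_simp at hL
    field_simp
    linarith

end Summit.AtomisticToContinuum.FouriersLaw.Theorems

end
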